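import Mathlib.Analysis.Calculus.BumpFunction.InnerProduct
import Mathlib.Analysis.Calculus.BumpFunction.Normed
import Mathlib.Analysis.Calculus.LineDeriv.IntegrationByParts
import Mathlib.Analysis.Calculus.MeanValue
import Mathlib.Analysis.InnerProductSpace.PiL2
import Mathlib.MeasureTheory.Integral.Bochner.Basic
import Mathlib.MeasureTheory.Measure.Haar.NormedSpace
import Mathlib.MeasureTheory.Measure.Lebesgue.EqHaar
import Mathlib.Analysis.SpecialFunctions.Pow.Real
import HarnessLib

/-!
# Transverse profiles of concentrated Mikado flows: compactly supported potentials on `ℝ^m`,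
their weighted Laplacians, energy, and concentration by rescaling

Euclidean half of the construction of the *stationary Mikado flows with concentration* of
A. Cheskidov, X. Luo, *Sharp nonuniqueness for the Navier–Stokes equations*, Invent. Math. 229
(2022) = arXiv:2009.06596, §4.1, (4.5)–(4.7) and Thm. 4.3: there the pipe profile in direction
`k` is `ψ_k(x) = μ^{(d-1)/2} ψ(μ dist(l_k, x))` with `ψ, φ ∈ C_c^∞` radial in the `d - 1` transverse
variables and `Δφ_k = ψ_k`, `∫ ψ_k² = 1`; the potential `φ_k` is what gains the factor `σ⁻¹` in
the antidivergence of oscillatory products. This file builds, on the transverse space `ℝ^m`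
(`m` a finite index type, `m = d - 1` downstream), the profiles TOGETHER WITH TWO GENERATIONS OF
POTENTIALS from a single compactly supported bump, for a *weighted* Laplacian
`𝓛_c = ∑ₗ cₗ ∂ₗ²` (`cₗ > 0`; the Laplacian of `ℝ^d` restricted to functions of integer transverse
forms `2xᵢ - xⱼ, x_l` is such an operator, with weights `5, 1, …, 1`):

* `Transverse.pd l F = ∂ₗF`, `Transverse.wLap c F = 𝓛_c F` on `ℝ^m = EuclideanSpace ℝ m`, with
  smoothness, supports, linearity, **integration by parts** `∫ G ∂ₗF = -∫ ∂ₗG F`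
  (`integral_mul_pd`, Mathlib's `integral_mul_fderiv_eq_neg_fderiv_mul_of_integrable`), the
  **energy identity** `∫ F 𝓛_cF = -∑ cₗ ∫ (∂ₗF)²` (`integral_mul_wLap`) and its consequence, the
  **unique continuation** `𝓛_c F ≡ 0, F ∈ C_c^∞ ⇒ F ≡ 0` (`eq_zero_of_wLap_eq_zero`);
* the base bump `Θ₀` (`Transverse.theta0`, a `ContDiffBump` at the cube centre `c₀ = (½,…,½)`
  with radii `1/8 < 1/4`), `φ₀ = 𝓛_cΘ₀`, `ψ₀ = 𝓛_cφ₀` (`phi0`, `psi0`), all `C_c^∞(B̄(c₀, 1/4))`, and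
  the energy `N₀ = ∫ ψ₀² > 0` (`energy0_pos`);
* concentration `rescale a μ f (z) = μ^a f(c₀ + μ(z - c₀))` with `∂ₗ ∘ rescale a μ = rescale (a+1) μ ∘ ∂ₗ`
  (`pd_rescale`), `𝓛_c ∘ rescale a μ = rescale (a+2) μ ∘ 𝓛_c` (`wLap_rescale`), supports in
  `B̄(c₀, r/μ)`, the sup bound `μ^a sup|f|`, and the exact integral scalings
  `∫ rescale a μ f = μ^{a-m} ∫ f`, `∫ |rescale a μ f|^p = μ^{ap-m} ∫|f|^p`,
  `∫ (rescale a μ f)(rescale a μ g) = μ^{2a-m} ∫ fg` (Mathlib's `Measure.integral_comp_smul`);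
* the **normalised concentrated profiles** `Transverse.thetaC c μ`, `phiC c μ`, `psiC c μ`
  (amplitudes `N₀^{-1/2} μ^{m/2 - 4}`, `N₀^{-1/2} μ^{m/2 - 2}`, `N₀^{-1/2} μ^{m/2}`) with
  `𝓛_c thetaC = phiC`, `𝓛_c phiC = psiC` (`wLap_thetaC`, `wLap_phiC`), **unit energy**
  `∫ psiC² = 1` (`integral_psiC_sq`), zero means of `phiC`, `psiC`, supports in
  `B̄(c₀, 1/(4μ)) ⊂ (0,1)^m` for `μ ≥ 1` — exactly the scaling `μ^{(d-1)/2 - (d-1)/p}` of CL22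
  Thm. 4.3 (2) once periodised and pulled back to `𝕋^d` (done in sibling files).

Everything is proved; no named facts. Part of the decomposition of
`Torus.CheskidovLuo2022ConvexIntegration` (CL22 Prop. 4.1, `NavierStokesReynoldsSteps`).

## Mathlib search

Mathlib (this pin): `ContDiffBump`, `integral_mul_fderiv_eq_neg_fderiv_mul_of_integrable`
(integration by parts along a direction on a finite-dimensional space with Haar measure),
`is_const_of_fderiv_eq_zero`, `Measure.integral_comp_smul_of_nonneg`, `integral_sub_right_eq_self`,
`integral_pos_iff_support_of_nonneg`; no Mikado/pipe-flow profiles (searched `Mikado`, `pipe`: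
nothing outside `Literature/` docstrings).

## References

* A. Cheskidov, X. Luo, Invent. Math. 229 (2022) = arXiv:2009.06596, §4.1 (4.5)–(4.7), Thm. 4.3.
  [`CheskidovLuo2022`]
-/

noncomputable section

open Set Filter Topology Function MeasureTheory Metric Module
open scoped ContDiff

namespace Literature.Analysis.FluidPDE

namespace Transverse

variable {m : Type*} [Fintype m]

/-! ## The cube centre, the base bump, concentration -/

section Bump

variable {F G : EuclideanSpace ℝ m → ℝ} {μ : ℝ}

variable (m) in
/-- The centre `c₀ = (1/2, …, 1/2)` of the unit cube of `ℝ^m`. [folklore] -/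
def centre : EuclideanSpace ℝ m := WithLp.toLp 2 fun _ => 1 / 2

variable (m) in
/-- The base bump `Θ₀`: Mathlib's `ContDiffBump` centred at `c₀` with radii `1/8 < 1/4`
(CL22 take `φ, ψ ∈ C_c^∞([1/2, 1])` radial; any bump serves). [cite: CheskidovLuo2022, §4.1 (4.5)–(4.7)] -/
def baseBump : ContDiffBump (centre m) where
  rIn := 1 / 8
  rOut := 1 / 4
  rIn_pos := by norm_num
  rIn_lt_rOut := by norm_num

variable (m) in
/-- `Θ₀` as a real function on `ℝ^m`. [folklore] -/
def theta0 : EuclideanSpace ℝ m → ℝ := baseBump m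

/-- `Θ₀ ∈ C^∞`. [folklore] -/
theorem contDiff_theta0 : ContDiff ℝ ∞ (theta0 m) := (baseBump m).contDiff

/-- `Θ₀` has compact support. [folklore] -/
theorem hasCompactSupport_theta0 : HasCompactSupport (theta0 m) := (baseBump m).hasCompactSupport

/-- `tsupport Θ₀ = B̄(c₀, 1/4)`. [folklore] -/
theorem tsupport_theta0 : tsupport (theta0 m) = closedBall (centre m) (1 / 4) := (baseBump m).tsupport_eq

/-- `Θ₀(c₀) = 1`. [folklore] -/
theorem theta0_centre : theta0 m (centre m) = 1 :=
  (baseBump m).one_of_mem_closedBall (mem_closedBall_self (by norm_num [baseBump]))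

/-- A compactly supported function on `ℝ^m`, `m` nonempty, vanishes somewhere. [folklore] -/
theorem exists_eq_zero_of_hasCompactSupport [Nonempty m] (hFc : HasCompactSupport F) : ∃ z, F z = 0 := by
  by_contra h
  push Not at h
  have : tsupport F = univ := eq_univ_of_forall fun z => subset_tsupport F (mem_support.2 (h z))
  have hc : IsCompact (univ : Set (EuclideanSpace ℝ m)) := this ▸ hFc
  exact noncompact_univ (EuclideanSpace ℝ m) hc

variable (m) in
/-- The affine map `A_μ z = c₀ + μ (z - c₀)` (dilation about the cube centre). [folklore] -/
def scaleAt (μ : ℝ) (z : EuclideanSpace ℝ m) : EuclideanSpace ℝ m := centre m + μ • (z - centre m)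

/-- **Concentration**: `rescale a μ f (z) = μ^a f(c₀ + μ(z - c₀))` (CL22 (4.5)/(4.6):
`μ^{(d-1)/2} ψ(μ·)`, `μ^{(d-1)/2 - 2} φ(μ·)`). [cite: CheskidovLuo2022, §4.1 (4.5)–(4.6)] -/
def rescale (a μ : ℝ) (f : EuclideanSpace ℝ m → ℝ) (z : EuclideanSpace ℝ m) : ℝ := μ ^ a * f (scaleAt m μ z)

omit [Fintype m] in
/-- Unfolding `rescale`. [folklore] -/
theorem rescale_apply (a μ : ℝ) (f : EuclideanSpace ℝ m → ℝ) (z : EuclideanSpace ℝ m) :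
    rescale a μ f z = μ ^ a * f (scaleAt m μ z) := rfl

/-- `A_μ` is smooth. [folklore] -/
theorem contDiff_scaleAt (μ : ℝ) : ContDiff ℝ ∞ (scaleAt m μ) :=
  contDiff_const.add ((contDiff_id.sub contDiff_const).const_smul μ)

/-- `D A_μ = μ · id`. [folklore] -/
theorem hasFDerivAt_scaleAt (μ : ℝ) (z : EuclideanSpace ℝ m) :
    HasFDerivAt (scaleAt m μ) (μ • ContinuousLinearMap.id ℝ (EuclideanSpace ℝ m)) z := by
  have h := (((hasFDerivAt_id (𝕜 := ℝ) z).sub_const (centre m)).const_smul μ).const_add (centre m)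
  exact h

/-- `dist (A_μ z) c₀ = μ dist z c₀` for `μ ≥ 0`. [folklore] -/
theorem dist_scaleAt (hμ : 0 ≤ μ) (z : EuclideanSpace ℝ m) :
    dist (scaleAt m μ z) (centre m) = μ * dist z (centre m) := by
  rw [scaleAt, dist_eq_norm, dist_eq_norm, add_sub_cancel_left, norm_smul, Real.norm_of_nonneg hμ]

/-- Concentrated smooth functions are smooth. [folklore] -/
theorem contDiff_rescale (hF : ContDiff ℝ ∞ F) (a μ : ℝ) : ContDiff ℝ ∞ (rescale a μ F) :=
  contDiff_const.mul (hF.comp (contDiff_scaleAt μ))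

/-- Support of the concentrated function: `tsupport f ⊆ B̄(c₀, r)` gives
`tsupport (rescale a μ f) ⊆ B̄(c₀, r/μ)` (`μ > 0`). [folklore] -/
theorem tsupport_rescale_subset {r : ℝ} (hμ : 0 < μ) (hF : tsupport F ⊆ closedBall (centre m) r) (a : ℝ) :
    tsupport (rescale a μ F) ⊆ closedBall (centre m) (r / μ) := by
  refine closure_minimal (fun z hz => ?_) isClosed_closedBall
  have hz' : F (scaleAt m μ z) ≠ 0 := fun h => hz (by simp [rescale_apply, h])
  have hmem := hF (subset_tsupport F (mem_support.2 hz'))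
  rw [mem_closedBall, dist_scaleAt hμ.le] at hmem
  rw [mem_closedBall, le_div_iff₀ hμ, mul_comm]
  exact hmem

/-- Concentration preserves compact support. [folklore] -/
theorem hasCompactSupport_rescale (hμ : 0 < μ) (hF : HasCompactSupport F) (a : ℝ) :
    HasCompactSupport (rescale a μ F) := by
  obtain ⟨r, hr⟩ := hF.isCompact.isBounded.subset_closedBall (centre m)
  exact HasCompactSupport.of_support_subset_isCompact (isCompact_closedBall (centre m) (r / μ))
    ((subset_tsupport _).trans (tsupport_rescale_subset hμ hr a))

omit [Fintype m] in
/-- Sup bound: `|rescale a μ f| ≤ μ^a sup|f|`. [folklore] -/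
theorem abs_rescale_le {B : ℝ} (hμ : 0 < μ) (hB : ∀ z, |F z| ≤ B) (a : ℝ) (z : EuclideanSpace ℝ m) :
    |rescale a μ F z| ≤ μ ^ a * B := by
  rw [rescale_apply, abs_mul, abs_of_pos (Real.rpow_pos_of_pos hμ a)]
  exact mul_le_mul_of_nonneg_left (hB _) (Real.rpow_pos_of_pos hμ a).le

/-- **Change of variables under `A_μ`**: `∫ H(A_μ z) dz = μ^{-m} ∫ H` (translation invariance and
the scaling of Lebesgue measure, `finrank ℝ^m = m`). [folklore] -/
theorem integral_comp_scaleAt (hμ : 0 < μ) (H : EuclideanSpace ℝ m → ℝ) :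
    ∫ z, H (scaleAt m μ z) = (μ ^ Fintype.card m)⁻¹ * ∫ z, H z := by
  have h1 : (fun z => H (scaleAt m μ z)) = fun z => (fun w => H (centre m + μ • w)) (z - centre m) := by
    funext z; rfl
  rw [h1, integral_sub_right_eq_self (fun w => H (centre m + μ • w)) (centre m)]
  have h2 := Measure.integral_comp_smul_of_nonneg (μ := (volume : Measure (EuclideanSpace ℝ m)))
    (fun w => H (centre m + w)) μ (hR := hμ.le)
  rw [finrank_euclideanSpace, smul_eq_mul] at h2
  rw [h2, integral_add_left_eq_self H (centre m)]

/-- `∫ rescale a μ f = μ^{a-m} ∫ f`. [folklore] -/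
theorem integral_rescale (hμ : 0 < μ) (a : ℝ) (F : EuclideanSpace ℝ m → ℝ) :
    ∫ z, rescale a μ F z = μ ^ (a - Fintype.card m) * ∫ z, F z := by
  simp only [rescale_apply, integral_const_mul]
  rw [integral_comp_scaleAt hμ F, ← mul_assoc, Real.rpow_sub hμ, Real.rpow_natCast, div_eq_mul_inv]

/-- `∫ |rescale a μ f|^p = μ^{ap-m} ∫ |f|^p` (`p` real): the `L^p` scaling `μ^{a - m/p}` of
concentrated profiles (CL22 Thm. 4.3 (2), transverse part). [cite: CheskidovLuo2022, Thm. 4.3 (2)] -/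
theorem integral_abs_rescale_rpow (hμ : 0 < μ) (a p : ℝ) (F : EuclideanSpace ℝ m → ℝ) :
    ∫ z, |rescale a μ F z| ^ p = μ ^ (a * p - Fintype.card m) * ∫ z, |F z| ^ p := by
  have h1 : ∀ z, |rescale a μ F z| ^ p = μ ^ (a * p) * |F (scaleAt m μ z)| ^ p := fun z => by
    rw [rescale_apply, abs_mul, abs_of_pos (Real.rpow_pos_of_pos hμ a),
      Real.mul_rpow (Real.rpow_pos_of_pos hμ a).le (abs_nonneg _), ← Real.rpow_mul hμ.le]
  simp_rw [h1]
  rw [integral_const_mul, integral_comp_scaleAt hμ (fun z => |F z| ^ p), ← mul_assoc, Real.rpow_sub hμ,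
    Real.rpow_natCast, div_eq_mul_inv]

/-- `∫ (rescale a μ f)(rescale a μ g) = μ^{2a-m} ∫ f g`. [folklore] -/
theorem integral_rescale_mul_rescale (hμ : 0 < μ) (a : ℝ) (F G : EuclideanSpace ℝ m → ℝ) :
    ∫ z, rescale a μ F z * rescale a μ G z = μ ^ (2 * a - Fintype.card m) * ∫ z, F z * G z := by
  have h1 : ∀ z, rescale a μ F z * rescale a μ G z = μ ^ (2 * a) * (F (scaleAt m μ z) * G (scaleAt m μ z)) :=
    fun z => by rw [rescale_apply, rescale_apply, two_mul, Real.rpow_add hμ]; ring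
  simp_rw [h1]
  rw [integral_const_mul, integral_comp_scaleAt hμ (fun z => F z * G z), ← mul_assoc, Real.rpow_sub hμ,
    Real.rpow_natCast, div_eq_mul_inv]

end Bump

/-! ## Partial derivatives and the weighted Laplacian `𝓛_c = ∑ cₗ ∂ₗ²` -/

section Calculus

variable [DecidableEq m]
variable {F G : EuclideanSpace ℝ m → ℝ} {c : m → ℝ} {μ : ℝ}

/-- The coordinate partial derivative `∂ₗ F (z) = DF(z) eₗ` on `ℝ^m`. [folklore] -/
def pd (l : m) (F : EuclideanSpace ℝ m → ℝ) (z : EuclideanSpace ℝ m) : ℝ :=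
  fderiv ℝ F z (EuclideanSpace.single l 1)

/-- The weighted Laplacian `𝓛_c F = ∑ₗ cₗ ∂ₗ∂ₗ F`. [folklore] -/
def wLap (c : m → ℝ) (F : EuclideanSpace ℝ m → ℝ) (z : EuclideanSpace ℝ m) : ℝ :=
  ∑ l, c l * pd l (pd l F) z

omit [Fintype m] in
/-- Unfolding `pd`. [folklore] -/
theorem pd_apply (l : m) (F : EuclideanSpace ℝ m → ℝ) (z : EuclideanSpace ℝ m) :
    pd l F z = fderiv ℝ F z (EuclideanSpace.single l 1) := rfl

/-- Unfolding `wLap`. [folklore] -/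
theorem wLap_apply (c : m → ℝ) (F : EuclideanSpace ℝ m → ℝ) (z : EuclideanSpace ℝ m) :
    wLap c F z = ∑ l, c l * pd l (pd l F) z := rfl

/-- Partial derivatives of smooth functions are smooth. [folklore] -/
theorem contDiff_pd (hF : ContDiff ℝ ∞ F) (l : m) : ContDiff ℝ ∞ (pd l F) :=
  (hF.fderiv_right le_rfl).clm_apply contDiff_const

/-- `𝓛_c F` is smooth for smooth `F`. [folklore] -/
theorem contDiff_wLap (hF : ContDiff ℝ ∞ F) (c : m → ℝ) : ContDiff ℝ ∞ (wLap c F) :=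
  ContDiff.sum fun l _ => contDiff_const.mul (contDiff_pd (contDiff_pd hF l) l)

omit [Fintype m] in
/-- `tsupport ∂ₗF ⊆ tsupport F`. [folklore] -/
theorem tsupport_pd_subset (F : EuclideanSpace ℝ m → ℝ) (l : m) : tsupport (pd l F) ⊆ tsupport F :=
  tsupport_fderiv_apply_subset ℝ (EuclideanSpace.single l 1)

omit [Fintype m] in
/-- Partial derivatives preserve compact support. [folklore] -/
theorem hasCompactSupport_pd (hF : HasCompactSupport F) (l : m) : HasCompactSupport (pd l F) :=
  hF.fderiv_apply (𝕜 := ℝ) (EuclideanSpace.single l 1)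

/-- `tsupport 𝓛_cF ⊆ tsupport F`. [folklore] -/
theorem tsupport_wLap_subset (c : m → ℝ) (F : EuclideanSpace ℝ m → ℝ) : tsupport (wLap c F) ⊆ tsupport F := by
  refine closure_minimal (fun z hz => ?_) (isClosed_tsupport F)
  by_contra h
  refine hz (Finset.sum_eq_zero fun l _ => ?_)
  have : z ∉ tsupport (pd l (pd l F)) := fun h' =>
    h ((tsupport_pd_subset (pd l F) l).trans (tsupport_pd_subset F l) h')
  rw [image_eq_zero_of_notMem_tsupport this, mul_zero]

/-- `𝓛_c` preserves compact support. [folklore] -/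
theorem hasCompactSupport_wLap (hF : HasCompactSupport F) (c : m → ℝ) : HasCompactSupport (wLap c F) :=
  hF.of_isClosed_subset (isClosed_tsupport _) (tsupport_wLap_subset c F)

/-- `∂ₗ (a F) = a ∂ₗF`. [folklore] -/
theorem pd_const_mul (hF : ContDiff ℝ ∞ F) (a : ℝ) (l : m) :
    pd l (fun z => a * F z) = fun z => a * pd l F z := by
  funext z
  simp only [pd_apply]
  rw [fderiv_const_mul ((hF.differentiable (by simp)) z)]
  rfl

/-- `𝓛_c (a F) = a 𝓛_c F`. [folklore] -/
theorem wLap_const_mul (hF : ContDiff ℝ ∞ F) (a : ℝ) (c : m → ℝ) :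
    wLap c (fun z => a * F z) = fun z => a * wLap c F z := by
  funext z
  simp only [wLap_apply, pd_const_mul hF, pd_const_mul (contDiff_pd hF _), Finset.mul_sum]
  exact Finset.sum_congr rfl fun l _ => by ring

/-! ### Integration by parts, energy, unique continuation -/

/-- `∫ ∂ₗF = 0` for `F ∈ C_c^∞(ℝ^m)`. [folklore] -/
theorem integral_pd_eq_zero (hF : ContDiff ℝ ∞ F) (hFc : HasCompactSupport F) (l : m) :
    ∫ z, pd l F z = 0 := by
  have hi : Integrable (pd l F) :=
    (contDiff_pd hF l).continuous.integrable_of_hasCompactSupport (hasCompactSupport_pd hFc l)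
  have hiF : Integrable F := hF.continuous.integrable_of_hasCompactSupport hFc
  have h : ∫ z, (fun _ : EuclideanSpace ℝ m => (1 : ℝ)) z * fderiv ℝ F z (EuclideanSpace.single l 1) =
      -∫ z, fderiv ℝ (fun _ : EuclideanSpace ℝ m => (1 : ℝ)) z (EuclideanSpace.single l 1) * F z := by
    refine integral_mul_fderiv_eq_neg_fderiv_mul_of_integrable ?_ ?_ ?_
      (fun _ _ => differentiableAt_const _) (fun z _ => (hF.differentiable (by simp)) z)
    · simp only [fderiv_fun_const, Pi.zero_apply, zero_apply, zero_mul]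
      exact integrable_zero _ _ _
    · simp only [one_mul]; exact hi
    · simp only [one_mul]; exact hiF
  simp only [fderiv_fun_const, Pi.zero_apply, zero_apply, zero_mul, integral_zero, neg_zero,
    one_mul] at h
  exact h

/-- **Integration by parts** `∫ G ∂ₗF = -∫ ∂ₗG F` for smooth `F` and `G ∈ C_c^∞`. [folklore] -/
theorem integral_mul_pd (hF : ContDiff ℝ ∞ F) (hG : ContDiff ℝ ∞ G) (hGc : HasCompactSupport G) (l : m) :
    ∫ z, G z * pd l F z = -∫ z, pd l G z * F z := by
  have hi1 : Integrable (fun z => pd l G z * F z) :=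
    ((contDiff_pd hG l).continuous.mul hF.continuous).integrable_of_hasCompactSupport
      ((hasCompactSupport_pd hGc l).mul_right)
  have hi2 : Integrable (fun z => G z * pd l F z) :=
    (hG.continuous.mul (contDiff_pd hF l).continuous).integrable_of_hasCompactSupport hGc.mul_right
  have hi3 : Integrable (fun z => G z * F z) :=
    (hG.continuous.mul hF.continuous).integrable_of_hasCompactSupport hGc.mul_right
  exact integral_mul_fderiv_eq_neg_fderiv_mul_of_integrable hi1 hi2 hi3
    (fun z _ => (hG.differentiable (by simp)) z) (fun z _ => (hF.differentiable (by simp)) z)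

/-- `∫ 𝓛_c F = 0` for `F ∈ C_c^∞(ℝ^m)` (so every `𝓛_c`-image has zero mean). [folklore] -/
theorem integral_wLap_eq_zero (hF : ContDiff ℝ ∞ F) (hFc : HasCompactSupport F) (c : m → ℝ) :
    ∫ z, wLap c F z = 0 := by
  have hi : ∀ l, Integrable (fun z => c l * pd l (pd l F) z) := fun l =>
    (continuous_const.mul (contDiff_pd (contDiff_pd hF l) l).continuous).integrable_of_hasCompactSupport
      ((hasCompactSupport_pd (hasCompactSupport_pd hFc l) l).mul_left)
  simp only [wLap_apply]
  rw [integral_finsetSum _ fun l _ => hi l]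
  refine Finset.sum_eq_zero fun l _ => ?_
  rw [integral_const_mul, integral_pd_eq_zero (contDiff_pd hF l) (hasCompactSupport_pd hFc l) l, mul_zero]

/-- **The energy identity** `∫ F 𝓛_cF = -∑ₗ cₗ ∫ (∂ₗF)²` for `F ∈ C_c^∞(ℝ^m)`. [folklore] -/
theorem integral_mul_wLap (hF : ContDiff ℝ ∞ F) (hFc : HasCompactSupport F) (c : m → ℝ) :
    ∫ z, F z * wLap c F z = -∑ l, c l * ∫ z, pd l F z * pd l F z := by
  have hi : ∀ l, Integrable (fun z => F z * (c l * pd l (pd l F) z)) := fun l =>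
    (hF.continuous.mul (continuous_const.mul (contDiff_pd (contDiff_pd hF l) l).continuous)).integrable_of_hasCompactSupport
      hFc.mul_right
  simp only [wLap_apply, Finset.mul_sum]
  rw [integral_finsetSum _ fun l _ => hi l, ← Finset.sum_neg_distrib]
  refine Finset.sum_congr rfl fun l _ => ?_
  have h1 : (fun z => F z * (c l * pd l (pd l F) z)) = fun z => c l * (F z * pd l (pd l F) z) := by
    funext z; ring
  rw [h1, integral_const_mul, integral_mul_pd (contDiff_pd hF l) hF hFc l, mul_neg]

/-- **Unique continuation for `𝓛_c` on `C_c^∞` by the energy method**: if `cₗ > 0` and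
`F ∈ C_c^∞(ℝ^m)` satisfies `𝓛_c F ≡ 0`, then `F ≡ 0` (`∑ cₗ ∫ (∂ₗF)² = 0` forces `DF ≡ 0`, so `F` is
constant and vanishes off its support). [folklore] -/
theorem eq_zero_of_wLap_eq_zero [Nonempty m] (hc : ∀ l, 0 < c l) (hF : ContDiff ℝ ∞ F)
    (hFc : HasCompactSupport F) (h0 : ∀ z, wLap c F z = 0) : ∀ z, F z = 0 := by
  have hE : ∑ l, c l * ∫ z, pd l F z * pd l F z = 0 := by
    have := integral_mul_wLap hF hFc c
    simp only [h0, mul_zero, integral_zero] at this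
    linarith
  have hnn : ∀ l, 0 ≤ ∫ z, pd l F z * pd l F z := fun l => integral_nonneg fun z => mul_self_nonneg _
  have hl : ∀ l, ∫ z, pd l F z * pd l F z = 0 := by
    intro l
    have h1 : ∀ l ∈ Finset.univ, 0 ≤ c l * ∫ z, pd l F z * pd l F z :=
      fun l _ => mul_nonneg (hc l).le (hnn l)
    have := (Finset.sum_eq_zero_iff_of_nonneg h1).1 hE l (Finset.mem_univ l)
    rcases mul_eq_zero.1 this with h | h
    · exact absurd h (hc l).ne'
    · exact h
  have hpd : ∀ l z, pd l F z = 0 := by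
    intro l
    have hcont : Continuous fun z => pd l F z * pd l F z :=
      (contDiff_pd hF l).continuous.mul (contDiff_pd hF l).continuous
    have hint : Integrable (fun z => pd l F z * pd l F z) :=
      hcont.integrable_of_hasCompactSupport (hasCompactSupport_pd hFc l).mul_right
    have hae := (integral_eq_zero_iff_of_nonneg (fun z => mul_self_nonneg _) hint).1 (hl l)
    have heq : (fun z => pd l F z * pd l F z) = 0 := hcont.ae_eq_iff_eq volume continuous_const |>.1 hae
    intro z
    have := congr_fun heq z
    simpa using this
  have hfd : ∀ z, fderiv ℝ F z = 0 := by
    intro z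
    refine ContinuousLinearMap.ext fun v => ?_
    have hv : v = ∑ l, v l • EuclideanSpace.single l (1 : ℝ) := by
      simpa using (EuclideanSpace.basisFun m ℝ).sum_repr v |>.symm
    rw [hv, map_sum]
    simp only [map_smul, zero_apply]
    exact Finset.sum_eq_zero fun l _ => by rw [← pd_apply, hpd l z, smul_zero]
  obtain ⟨z₀, hz₀⟩ := exists_eq_zero_of_hasCompactSupport hFc
  intro z
  rw [← hz₀]
  exact is_const_of_fderiv_eq_zero (hF.differentiable (by simp)) hfd z z₀

/-- If `cₗ > 0` and `F ∈ C_c^∞` is not identically zero, neither is `𝓛_c F`. [folklore] -/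
theorem exists_wLap_ne_zero [Nonempty m] (hc : ∀ l, 0 < c l) (hF : ContDiff ℝ ∞ F)
    (hFc : HasCompactSupport F) (hne : ∃ z, F z ≠ 0) : ∃ z, wLap c F z ≠ 0 := by
  by_contra h
  push Not at h
  obtain ⟨z, hz⟩ := hne
  exact hz (eq_zero_of_wLap_eq_zero hc hF hFc h z)

/-! ### Concentration and derivatives -/

/-- **`∂ₗ (rescale a μ f) = rescale (a+1) μ (∂ₗ f)`** (`μ > 0`): each derivative costs a factor `μ`
(CL22 Thm. 4.3 (2): `μ^{-m}‖∇^m W_k‖`). [cite: CheskidovLuo2022, Thm. 4.3 (2)] -/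
theorem pd_rescale (hμ : 0 < μ) (hF : ContDiff ℝ ∞ F) (a : ℝ) (l : m) :
    pd l (rescale a μ F) = rescale (a + 1) μ (pd l F) := by
  funext z
  have hd : HasFDerivAt (fun w => F (scaleAt m μ w))
      ((fderiv ℝ F (scaleAt m μ z)).comp (μ • ContinuousLinearMap.id ℝ _)) z :=
    ((hF.differentiable (by simp)) _).hasFDerivAt.comp z (hasFDerivAt_scaleAt μ z)
  rw [pd_apply, rescale_apply, show rescale a μ F = fun w => μ ^ a * F (scaleAt m μ w) from rfl,
    fderiv_const_mul hd.differentiableAt, hd.fderiv]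
  rw [_root_.smul_apply, ContinuousLinearMap.comp_apply, _root_.smul_apply,
    ContinuousLinearMap.id_apply, map_smul, smul_eq_mul, smul_eq_mul, pd_apply, Real.rpow_add hμ, Real.rpow_one]
  ring

/-- **`𝓛_c (rescale a μ f) = rescale (a+2) μ (𝓛_c f)`** (`μ > 0`). [folklore] -/
theorem wLap_rescale (hμ : 0 < μ) (hF : ContDiff ℝ ∞ F) (a : ℝ) (c : m → ℝ) :
    wLap c (rescale a μ F) = rescale (a + 2) μ (wLap c F) := by
  funext z
  simp only [wLap_apply, pd_rescale hμ hF, pd_rescale hμ (contDiff_pd hF _), rescale_apply, Finset.mul_sum]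
  refine Finset.sum_congr rfl fun l _ => ?_
  rw [show a + 1 + 1 = a + 2 by ring]
  ring

/-! ## The profiles `φ₀ = 𝓛Θ₀`, `ψ₀ = 𝓛φ₀` and the energy `N₀` -/

/-- `φ₀ = 𝓛_c Θ₀` (first-generation potential profile). [cite: CheskidovLuo2022, §4.1 (4.6)–(4.7)] -/
def phi0 (c : m → ℝ) : EuclideanSpace ℝ m → ℝ := wLap c (theta0 m)

/-- `ψ₀ = 𝓛_c φ₀ = 𝓛_c² Θ₀` (the unnormalised transverse pipe profile; CL22 (4.7):
`Δφ_k = ψ_k`). [cite: CheskidovLuo2022, §4.1 (4.7)] -/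
def psi0 (c : m → ℝ) : EuclideanSpace ℝ m → ℝ := wLap c (phi0 c)

/-- `φ₀ ∈ C^∞`. [folklore] -/
theorem contDiff_phi0 (c : m → ℝ) : ContDiff ℝ ∞ (phi0 c) := contDiff_wLap contDiff_theta0 c

/-- `ψ₀ ∈ C^∞`. [folklore] -/
theorem contDiff_psi0 (c : m → ℝ) : ContDiff ℝ ∞ (psi0 c) := contDiff_wLap (contDiff_phi0 c) c

/-- `φ₀` has compact support. [folklore] -/
theorem hasCompactSupport_phi0 (c : m → ℝ) : HasCompactSupport (phi0 c) :=
  hasCompactSupport_wLap hasCompactSupport_theta0 c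

/-- `ψ₀` has compact support. [folklore] -/
theorem hasCompactSupport_psi0 (c : m → ℝ) : HasCompactSupport (psi0 c) :=
  hasCompactSupport_wLap (hasCompactSupport_phi0 c) c

/-- `tsupport φ₀ ⊆ B̄(c₀, 1/4)`. [folklore] -/
theorem tsupport_phi0_subset (c : m → ℝ) : tsupport (phi0 c) ⊆ closedBall (centre m) (1 / 4) :=
  (tsupport_wLap_subset c _).trans tsupport_theta0.le

/-- `tsupport ψ₀ ⊆ B̄(c₀, 1/4)`. [folklore] -/
theorem tsupport_psi0_subset (c : m → ℝ) : tsupport (psi0 c) ⊆ closedBall (centre m) (1 / 4) :=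
  (tsupport_wLap_subset c _).trans (tsupport_phi0_subset c)

/-- The energy `N₀ = ∫ ψ₀²` of the unnormalised profile. [cite: CheskidovLuo2022, §4.1 (4.7)] -/
def energy0 (c : m → ℝ) : ℝ := ∫ z, psi0 c z * psi0 c z

/-- **`N₀ > 0`** for positive weights: `Θ₀(c₀) = 1`, so `φ₀ = 𝓛Θ₀ ≢ 0` and `ψ₀ = 𝓛φ₀ ≢ 0` by unique
continuation, and a continuous nonnegative function that is not identically zero has positive
integral. [folklore] -/
theorem energy0_pos [Nonempty m] (hc : ∀ l, 0 < c l) : 0 < energy0 c := by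
  have h1 : ∃ z, phi0 c z ≠ 0 :=
    exists_wLap_ne_zero hc contDiff_theta0 hasCompactSupport_theta0 ⟨centre m, by rw [theta0_centre]; norm_num⟩
  have h2 : ∃ z, psi0 c z ≠ 0 := exists_wLap_ne_zero hc (contDiff_phi0 c) (hasCompactSupport_phi0 c) h1
  have hcont : Continuous fun z => psi0 c z * psi0 c z :=
    (contDiff_psi0 c).continuous.mul (contDiff_psi0 c).continuous
  have hint : Integrable (fun z => psi0 c z * psi0 c z) :=
    hcont.integrable_of_hasCompactSupport (hasCompactSupport_psi0 c).mul_right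
  rw [energy0, integral_pos_iff_support_of_nonneg (fun z => mul_self_nonneg _) hint]
  refine (hcont.isOpen_support).measure_pos volume ?_
  obtain ⟨z, hz⟩ := h2
  exact ⟨z, by simpa using hz⟩

/-- The normalising constant `N₀^{-1/2}`. [folklore] -/
def normConst (c : m → ℝ) : ℝ := (Real.sqrt (energy0 c))⁻¹

/-- `(N₀^{-1/2})² N₀ = 1`. [folklore] -/
theorem normConst_sq_mul_energy0 [Nonempty m] (hc : ∀ l, 0 < c l) : normConst c ^ 2 * energy0 c = 1 := by
  rw [normConst, inv_pow, Real.sq_sqrt (energy0_pos hc).le, inv_mul_cancel₀ (energy0_pos hc).ne']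

/-! ## The normalised concentrated profiles `Θ_μ`, `φ_μ`, `ψ_μ` -/

/-- `Θ_μ = N₀^{-1/2} μ^{m/2 - 4} Θ₀(A_μ ·)` (second-generation potential, `𝓛Θ_μ = φ_μ`). [folklore] -/
def thetaC (c : m → ℝ) (μ : ℝ) (z : EuclideanSpace ℝ m) : ℝ :=
  normConst c * rescale ((Fintype.card m : ℝ) / 2 - 4) μ (theta0 m) z

/-- `φ_μ = N₀^{-1/2} μ^{m/2 - 2} φ₀(A_μ ·)` (first-generation potential, `𝓛φ_μ = ψ_μ`; CL22 (4.6)). [cite: CheskidovLuo2022, §4.1 (4.6)] -/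
def phiC (c : m → ℝ) (μ : ℝ) (z : EuclideanSpace ℝ m) : ℝ :=
  normConst c * rescale ((Fintype.card m : ℝ) / 2 - 2) μ (phi0 c) z

/-- `ψ_μ = N₀^{-1/2} μ^{m/2} ψ₀(A_μ ·)` (the transverse pipe profile with `∫ ψ_μ² = 1`; CL22 (4.5)). [cite: CheskidovLuo2022, §4.1 (4.5)] -/
def psiC (c : m → ℝ) (μ : ℝ) (z : EuclideanSpace ℝ m) : ℝ :=
  normConst c * rescale ((Fintype.card m : ℝ) / 2) μ (psi0 c) z

/-- `Θ_μ ∈ C^∞`. [folklore] -/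
theorem contDiff_thetaC (c : m → ℝ) (μ : ℝ) : ContDiff ℝ ∞ (thetaC c μ) :=
  contDiff_const.mul (contDiff_rescale contDiff_theta0 _ _)

/-- `φ_μ ∈ C^∞`. [folklore] -/
theorem contDiff_phiC (c : m → ℝ) (μ : ℝ) : ContDiff ℝ ∞ (phiC c μ) :=
  contDiff_const.mul (contDiff_rescale (contDiff_phi0 c) _ _)

/-- `ψ_μ ∈ C^∞`. [folklore] -/
theorem contDiff_psiC (c : m → ℝ) (μ : ℝ) : ContDiff ℝ ∞ (psiC c μ) :=
  contDiff_const.mul (contDiff_rescale (contDiff_psi0 c) _ _)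

omit [Fintype m] [DecidableEq m] in
/-- `tsupport` of a constant multiple. [folklore] -/
theorem tsupport_const_mul_subset (a : ℝ) (F : EuclideanSpace ℝ m → ℝ) :
    tsupport (fun z => a * F z) ⊆ tsupport F :=
  tsupport_mul_subset_right (f := fun _ => a) (g := F)

/-- `tsupport Θ_μ ⊆ B̄(c₀, 1/(4μ))` (`μ > 0`). [folklore] -/
theorem tsupport_thetaC_subset (c : m → ℝ) (hμ : 0 < μ) :
    tsupport (thetaC c μ) ⊆ closedBall (centre m) (1 / 4 / μ) :=
  (tsupport_const_mul_subset _ _).trans (tsupport_rescale_subset hμ tsupport_theta0.le _)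

/-- `tsupport φ_μ ⊆ B̄(c₀, 1/(4μ))` (`μ > 0`). [folklore] -/
theorem tsupport_phiC_subset (c : m → ℝ) (hμ : 0 < μ) :
    tsupport (phiC c μ) ⊆ closedBall (centre m) (1 / 4 / μ) :=
  (tsupport_const_mul_subset _ _).trans (tsupport_rescale_subset hμ (tsupport_phi0_subset c) _)

/-- `tsupport ψ_μ ⊆ B̄(c₀, 1/(4μ))` (`μ > 0`). [folklore] -/
theorem tsupport_psiC_subset (c : m → ℝ) (hμ : 0 < μ) :
    tsupport (psiC c μ) ⊆ closedBall (centre m) (1 / 4 / μ) :=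
  (tsupport_const_mul_subset _ _).trans (tsupport_rescale_subset hμ (tsupport_psi0_subset c) _)

/-- `Θ_μ` has compact support. [folklore] -/
theorem hasCompactSupport_thetaC (c : m → ℝ) (hμ : 0 < μ) : HasCompactSupport (thetaC c μ) :=
  (hasCompactSupport_rescale hμ hasCompactSupport_theta0 _).mul_left

/-- `φ_μ` has compact support. [folklore] -/
theorem hasCompactSupport_phiC (c : m → ℝ) (hμ : 0 < μ) : HasCompactSupport (phiC c μ) :=
  (hasCompactSupport_rescale hμ (hasCompactSupport_phi0 c) _).mul_left

/-- `ψ_μ` has compact support. [folklore] -/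
theorem hasCompactSupport_psiC (c : m → ℝ) (hμ : 0 < μ) : HasCompactSupport (psiC c μ) :=
  (hasCompactSupport_rescale hμ (hasCompactSupport_psi0 c) _).mul_left

/-- **`𝓛_c Θ_μ = φ_μ`** (`μ > 0`). [folklore] -/
theorem wLap_thetaC (c : m → ℝ) (hμ : 0 < μ) : wLap c (thetaC c μ) = phiC c μ := by
  unfold thetaC phiC
  rw [wLap_const_mul (contDiff_rescale contDiff_theta0 _ _), wLap_rescale hμ contDiff_theta0]
  funext z
  rw [show (Fintype.card m : ℝ) / 2 - 4 + 2 = (Fintype.card m : ℝ) / 2 - 2 by ring]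
  rfl

/-- **`𝓛_c φ_μ = ψ_μ`** (`μ > 0`; CL22 (4.7): `Δφ_k = ψ_k`). [cite: CheskidovLuo2022, §4.1 (4.7)] -/
theorem wLap_phiC (c : m → ℝ) (hμ : 0 < μ) : wLap c (phiC c μ) = psiC c μ := by
  unfold phiC psiC
  rw [wLap_const_mul (contDiff_rescale (contDiff_phi0 c) _ _), wLap_rescale hμ (contDiff_phi0 c)]
  funext z
  rw [show (Fintype.card m : ℝ) / 2 - 2 + 2 = (Fintype.card m : ℝ) / 2 by ring]
  rfl

/-- **Unit energy** `∫ ψ_μ² = 1` (`μ > 0`; CL22 (4.7): `∫ ψ_k² = 1`). [cite: CheskidovLuo2022, §4.1 (4.7)] -/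
theorem integral_psiC_sq [Nonempty m] (hc : ∀ l, 0 < c l) (hμ : 0 < μ) :
    ∫ z, psiC c μ z * psiC c μ z = 1 := by
  have h1 : ∀ z, psiC c μ z * psiC c μ z =
      normConst c ^ 2 * (rescale ((Fintype.card m : ℝ) / 2) μ (psi0 c) z * rescale ((Fintype.card m : ℝ) / 2) μ (psi0 c) z) :=
    fun z => by unfold psiC; ring
  simp_rw [h1]
  rw [integral_const_mul, integral_rescale_mul_rescale hμ, show 2 * ((Fintype.card m : ℝ) / 2) - Fintype.card m = 0 by ring,
    Real.rpow_zero, one_mul]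
  exact normConst_sq_mul_energy0 hc

/-- `∫ ψ_μ = 0` (`μ > 0`). [folklore] -/
theorem integral_psiC (c : m → ℝ) (hμ : 0 < μ) : ∫ z, psiC c μ z = 0 := by
  rw [← wLap_phiC c hμ]
  exact integral_wLap_eq_zero (contDiff_phiC c μ) (hasCompactSupport_phiC c hμ) c

/-- `∫ φ_μ = 0` (`μ > 0`). [folklore] -/
theorem integral_phiC (c : m → ℝ) (hμ : 0 < μ) : ∫ z, phiC c μ z = 0 := by
  rw [← wLap_thetaC c hμ]
  exact integral_wLap_eq_zero (contDiff_thetaC c μ) (hasCompactSupport_thetaC c hμ) c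

end Calculus

end Transverse

end Literature.Analysis.FluidPDE
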